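import Literature.NumberTheory.GaloisRepresentations.ContinuousCohomologyFiniteTwoDevissage
import Literature.NumberTheory.GaloisRepresentations.ContinuousCohomologyConnectingNaturality
import Literature.NumberTheory.GaloisRepresentations.CorNaturality
import HarnessLib

/-!
# The RIGHT action of `Δ = G ⧸ W` on `Maps(G ⧸ W, M)` and on its cohomology: the `ℤ[Δ]`-module
# structure of `Hⁿ(G, Ind_W^G M) ≅ Hⁿ(W, M)` read on the coefficients (Serre, *Corps locaux* VII §5;
# NSW I §6)

Topic `NumberTheory/GaloisRepresentations` (continuous cochain cohomology); namespace
`Literature.NumberTheory.GaloisRepresentations` (dot notation under `ContinuousRep`).  Definitions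
with bodies and theorems; no named fact, no `sorry`, no instance, no notation.

Let `G` be a compact topological group, `W ⊴ G` an OPEN NORMAL subgroup, `Δ = G ⧸ W` (finite) and
`ρ` a continuous representation of `G` on a discrete `M`.  On `Maps(G ⧸ W, M)` (`ρ.coindOpen W hW`,
diagonal action `(g ⋆ φ)(y) = g • φ(g⁻¹ y)`) the RIGHT translations `(R_c φ)(y) = φ(y c)`, `c ∈ Δ`,
are `G`-equivariant (the tree's `ContinuousShapiroLift.rTransHom`; Serre, *Corps locaux* VII §5:
the `G/H`-module structure of the induced module "sur le second facteur" of `A ⊗ ℤ[G/H]`) and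
satisfy `R_1 = id`, `R_{cd} = R_c ∘ R_d`.  By functoriality of `Hⁿ(G, –)` in the coefficients they
make every `Hⁿ(G, Maps(G ⧸ W, M))` — which is `Hⁿ(W, M)` by Shapiro's lemma
(`ContinuousRep.shapiroOpenAddEquiv`) — a `ℤ[Δ]`-module, WITHOUT any conjugation action on the
cohomology of the subgroup `W`:

* §1 `ρ.coindOpenRTrans W hW c` (the endomorphism `R_c`), `coindOpenMap f` (functoriality of
  `Maps(G ⧸ W, –)` in `G`-morphisms `f : M → M′`), their formulas and commutation, `R_c ∘ unit = unit`;
* §2 **`ρ.coindOpenHRep W hW n : Representation ℤ (G ⧸ W) (Hⁿ(G, Maps(G ⧸ W, M)))`**, `c ↦ Hⁿ(R_c)`,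
  and the `Δ`-equivariance of `Hⁿ(coindOpenMap f)`;
* §3 degree `0` on invariants: **`ρ.coindOpenInvariantsRep W hW : Representation ℤ (G ⧸ W)
  (Maps(G ⧸ W, M)^G)`** and the `Δ`-equivariant identification
  **`coindOpenInvariantsEquiv : Maps(G ⧸ W, M)^G ≃ₗ[ℤ] M^W`**, `φ ↦ φ(1)`, intertwining `R_c` with the
  natural action of `Δ` on `M^W` (`ContinuousRep.quotientInvariants`): `H⁰(G, Ind_W^G M) = M^W` as
  `Δ`-modules;
* §4 short exact sequences: a short exact `0 → M₁ → M₂ → M₃ → 0` of discrete `G`-modules gives a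
  short exact `0 → Maps(Δ, M₁) → Maps(Δ, M₂) → Maps(Δ, M₃) → 0` (`IsSES.coindOpenMap`) whose
  connecting homomorphisms `δ₀`, `δ₁` (`ContinuousCohomologyConnecting`) COMMUTE with the `Δ`-actions
  (`δ₀_coindOpenRTrans`, `δ₁_coindOpenHRep`) — the long exact sequence of `Hⁿ(W, –)` is
  `Δ`-equivariant, by the naturality `IsSES.cohomologyMap_δ₀/δ₁` applied to the endomorphism
  `(R_c, R_c, R_c)`.

Lane «TATE-EPC-TC» of cell `bsd-eis` (crux `GoodLatticeBDPValue`, stmt-BirchSwinnertonDyer-19032),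
brick B2 file 2 ("functorial in `A` and in the RIGHT action of `G/U` on `ℤ[G/U]`"): with `G = G_{K₁,S}`,
`W = G_{L,S}`, `Δ = Gal(L/K₁)`, this is how the `Gal(L/K₁)`-module structure of `Hⁿ(G_{L,S}, μ_p)`,
`Hⁿ(G_{L,S}, E_S)` is read in the equivariant Euler-characteristic computation (Milne ADT I §5, proof
of Thm. 5.1, `χ′ : R(Ḡ) → R(Ḡ)`).  HONEST FRAMING: homological algebra only; no arithmetic statement
and no case of BSD is proved here.

## References
* J.-P. Serre, *Corps locaux* / *Local Fields* (1979), VII §5 (the `G/H`-module structure of the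
  induced module), VII §6. [SerreLocalFields1979]
* J. Neukirch, A. Schmidt, K. Wingberg, *Cohomology of Number Fields*, 2nd ed. (2008), I §6
  (induced modules), (1.3.2)–(1.3.3) (functoriality of the long exact sequence). [NeukirchSchmidtWingberg2008]
* J. S. Milne, *Arithmetic Duality Theorems*, 2nd ed. (2006), I §5 (proof of Thm. 5.1). [MilneADT2006]
-/

noncomputable section

open CategoryTheory Function
open scoped Topology

universe u

namespace Literature.NumberTheory.GaloisRepresentations

open _root_.TopRep _root_.ContRepresentation _root_.ContinuousCohomology

namespace ContinuousRep

/-! ## §1 Right translations and functoriality of `Maps(G ⧸ W, –)` -/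

section RTrans

variable {G : Type u} [Group G] [TopologicalSpace G] [IsTopologicalGroup G] [CompactSpace G]
variable {M : Type u} [AddCommGroup M] [TopologicalSpace M] [DiscreteTopology M]
variable {M' : Type u} [AddCommGroup M'] [TopologicalSpace M'] [DiscreteTopology M']
variable (ρ : ContinuousRep G ℤ M) (ρ' : ContinuousRep G ℤ M') (W : Subgroup G) [W.Normal]
  (hW : IsOpen (W : Set G))

/-- **Right translation `R_c`, `(R_c φ)(y) = φ(y c)`**, an endomorphism of the `G`-representation
`Maps(G ⧸ W, M)` (the tree's `rTransHom`, read on `ρ.coindOpen W hW`).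
[cite: SerreLocalFields1979, VII §5] -/
def coindOpenRTrans (c : G ⧸ W) : (ρ.coindOpen W hW).toTopRep ⟶ (ρ.coindOpen W hW).toTopRep :=
  rTransHom ρ.toTopRep W c

/-- Formula: `(R_c φ)(y) = φ(y c)`. [cite: SerreLocalFields1979, VII §5] -/
@[simp] theorem coindOpenRTrans_apply (c : G ⧸ W) (φ : G ⧸ W → M) (y : G ⧸ W) :
    (ρ.coindOpenRTrans W hW c).hom φ y = φ (y * c) := rfl

/-- `R_1 = id`. [cite: SerreLocalFields1979, VII §5] -/
theorem coindOpenRTrans_one_apply (φ : G ⧸ W → M) : (ρ.coindOpenRTrans W hW 1).hom φ = φ :=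
  funext fun y => by rw [coindOpenRTrans_apply, mul_one]

/-- `R_{cd} = R_c ∘ R_d` (a LEFT action of `Δ` on functions). [cite: SerreLocalFields1979, VII §5] -/
theorem coindOpenRTrans_mul_apply (c d : G ⧸ W) (φ : G ⧸ W → M) :
    (ρ.coindOpenRTrans W hW (c * d)).hom φ =
      (ρ.coindOpenRTrans W hW c).hom ((ρ.coindOpenRTrans W hW d).hom φ) :=
  funext fun y => by
    change φ (y * (c * d)) = φ (y * c * d)
    rw [mul_assoc]

/-- `R_{cd} = R_d ≫ R_c` as morphisms. [cite: SerreLocalFields1979, VII §5] -/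
theorem coindOpenRTrans_mul (c d : G ⧸ W) :
    ρ.coindOpenRTrans W hW (c * d) = ρ.coindOpenRTrans W hW d ≫ ρ.coindOpenRTrans W hW c := by
  ext φ y
  exact congr_fun (ρ.coindOpenRTrans_mul_apply W hW c d φ) y

/-- **Functoriality of `Maps(G ⧸ W, –)`**: a `G`-morphism `f : M → M′` gives `φ ↦ f ∘ φ`.
[cite: NeukirchSchmidtWingberg2008, I §6 (induced modules)] -/
def coindOpenMap (f : ρ.toTopRep ⟶ ρ'.toTopRep) :
    (ρ.coindOpen W hW).toTopRep ⟶ (ρ'.coindOpen W hW).toTopRep :=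
  TopRep.ofHom
    { toLinearMap :=
        { toFun := fun φ y => f.hom (φ y)
          map_add' := fun φ ψ => funext fun y => by
            change f.hom (φ y + ψ y) = f.hom (φ y) + f.hom (ψ y)
            rw [map_add]
          map_smul' := fun n φ => funext fun y => by
            change f.hom (n • φ y) = n • f.hom (φ y)
            rw [map_zsmul] }
      cont := continuous_pi fun y => f.hom.continuous.comp (_root_.continuous_apply y)
      isIntertwining' := fun g => by
        ext φ y
        change f.hom (ρ g (φ (g⁻¹ • y))) = ρ' g (f.hom (φ (g⁻¹ • y)))
        exact TopRep.hom_comm_apply f g _ }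

omit [W.Normal] in
/-- Formula: `(coindOpenMap f φ)(y) = f (φ y)`. [cite: NeukirchSchmidtWingberg2008, I §6 (induced modules)] -/
@[simp] theorem coindOpenMap_apply (f : ρ.toTopRep ⟶ ρ'.toTopRep) (φ : G ⧸ W → M) (y : G ⧸ W) :
    (ρ.coindOpenMap ρ' W hW f).hom φ y = f.hom (φ y) := rfl

/-- Right translations commute with `coindOpenMap f`. [cite: SerreLocalFields1979, VII §5] -/
theorem coindOpenRTrans_coindOpenMap (f : ρ.toTopRep ⟶ ρ'.toTopRep) (c : G ⧸ W) (φ : G ⧸ W → M) :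
    (ρ'.coindOpenRTrans W hW c).hom ((ρ.coindOpenMap ρ' W hW f).hom φ) =
      (ρ.coindOpenMap ρ' W hW f).hom ((ρ.coindOpenRTrans W hW c).hom φ) := rfl

/-- Right translations fix the constants: `R_c ∘ unit = unit`. [cite: SerreLocalFields1979, VII §5] -/
theorem coindOpenRTrans_coindOpenUnit (c : G ⧸ W) (m : M) :
    (ρ.coindOpenRTrans W hW c).hom ((ρ.coindOpenUnit W hW).hom m) = (ρ.coindOpenUnit W hW).hom m := rfl

omit [W.Normal] in
/-- `coindOpenMap` is natural with respect to the units. [cite: NeukirchSchmidtWingberg2008, I §6 (induced modules)] -/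
theorem coindOpenMap_coindOpenUnit (f : ρ.toTopRep ⟶ ρ'.toTopRep) (m : M) :
    (ρ.coindOpenMap ρ' W hW f).hom ((ρ.coindOpenUnit W hW).hom m) = (ρ'.coindOpenUnit W hW).hom (f.hom m) :=
  rfl

end RTrans

/-! ## §2 The `Δ`-action on `Hⁿ(G, Maps(G ⧸ W, M))` -/

section Cohomology

variable {G : Type u} [Group G] [TopologicalSpace G] [IsTopologicalGroup G] [CompactSpace G]
variable {M : Type u} [AddCommGroup M] [TopologicalSpace M] [DiscreteTopology M]
variable {M' : Type u} [AddCommGroup M'] [TopologicalSpace M'] [DiscreteTopology M']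
variable (ρ : ContinuousRep G ℤ M) (ρ' : ContinuousRep G ℤ M') (W : Subgroup G) [W.Normal]
  (hW : IsOpen (W : Set G))

/-- **`Hⁿ(G, Maps(G ⧸ W, M))` as a `ℤ[Δ]`-module, `Δ = G ⧸ W`**: `c ↦ Hⁿ(R_c)` (functoriality of
continuous cohomology in the coefficients; `R_1 = id`, `R_{cd} = R_c R_d`).  Under Shapiro's lemma
this is the `G/W`-module `Hⁿ(W, M)` of Serre VII §5, obtained here without any conjugation action.
[cite: SerreLocalFields1979, VII §5] [cite: NeukirchSchmidtWingberg2008, I §6 Prop. (1.6.4)] -/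
def coindOpenHRep (n : ℕ) :
    Representation ℤ (G ⧸ W) (continuousCohomology n (ρ.coindOpen W hW).toTopRep : Type u) where
  toFun c := (cohomologyMap (ρ.coindOpenRTrans W hW c) n).hom.toLinearMap
  map_one' := by
    haveI : DiscreteTopology (G ⧸ W → M) := discreteTopology_coindOpen W hW
    have h : cohomologyMap (ρ.coindOpenRTrans W hW 1) n = 𝟙 _ :=
      continuousCohomology_map_eq_id (ContinuousMonoidHom.id G) (resIdHom (ρ.coindOpenRTrans W hW 1))
        rfl (fun φ => ρ.coindOpenRTrans_one_apply W hW φ) n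
    ext x
    change (cohomologyMap (ρ.coindOpenRTrans W hW 1) n).hom x = x
    rw [h]
    rfl
  map_mul' := fun c d => by
    haveI : DiscreteTopology (G ⧸ W → M) := discreteTopology_coindOpen W hW
    ext x
    change (cohomologyMap (ρ.coindOpenRTrans W hW (c * d)) n).hom x =
      (cohomologyMap (ρ.coindOpenRTrans W hW c) n).hom ((cohomologyMap (ρ.coindOpenRTrans W hW d) n).hom x)
    rw [coindOpenRTrans_mul]
    exact cohomologyMap_comp_apply _ _ n x

/-- Unfolding: `coindOpenHRep n c x = Hⁿ(R_c) x`. [cite: SerreLocalFields1979, VII §5] -/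
theorem coindOpenHRep_apply (n : ℕ) (c : G ⧸ W) (x : continuousCohomology n (ρ.coindOpen W hW).toTopRep) :
    ρ.coindOpenHRep W hW n c x = (cohomologyMap (ρ.coindOpenRTrans W hW c) n).hom x := rfl

/-- **`Hⁿ(coindOpenMap f)` is `Δ`-equivariant.** [cite: NeukirchSchmidtWingberg2008, I §6 (induced modules)] -/
theorem coindOpenHRep_cohomologyMap (f : ρ.toTopRep ⟶ ρ'.toTopRep) (n : ℕ) (c : G ⧸ W)
    (x : continuousCohomology n (ρ.coindOpen W hW).toTopRep) :
    ρ'.coindOpenHRep W hW n c ((cohomologyMap (ρ.coindOpenMap ρ' W hW f) n).hom x) =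
      (cohomologyMap (ρ.coindOpenMap ρ' W hW f) n).hom (ρ.coindOpenHRep W hW n c x) := by
  haveI : DiscreteTopology (G ⧸ W → M) := discreteTopology_coindOpen W hW
  haveI : DiscreteTopology (G ⧸ W → M') := discreteTopology_coindOpen W hW
  rw [coindOpenHRep_apply, coindOpenHRep_apply, ← cohomologyMap_comp_apply, ← cohomologyMap_comp_apply]
  rfl

end Cohomology

/-! ## §3 Degree `0`: `Maps(G ⧸ W, M)^G = M^W` as `Δ`-modules -/

section Invariants

variable {G : Type u} [Group G] [TopologicalSpace G] [IsTopologicalGroup G] [CompactSpace G]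
variable {M : Type u} [AddCommGroup M] [TopologicalSpace M] [DiscreteTopology M]
variable (ρ : ContinuousRep G ℤ M) (W : Subgroup G) [W.Normal] (hW : IsOpen (W : Set G))

/-- Right translations preserve the `G`-invariants of `Maps(G ⧸ W, M)` (they are `G`-equivariant).
[cite: SerreLocalFields1979, VII §5] -/
theorem coindOpenRTrans_mem_invariants (c : G ⧸ W) (φ : (ρ.coindOpen W hW).toTopRep.ρ.invariants) :
    (ρ.coindOpenRTrans W hW c).hom (φ : G ⧸ W → M) ∈ (ρ.coindOpen W hW).toTopRep.ρ.invariants :=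
  fun g => by
    change (ρ.coindOpen W hW) g ((ρ.coindOpenRTrans W hW c).hom φ) = _
    rw [← ContinuousRep.hom_comm_apply (ρ.coindOpenRTrans W hW c) g]
    exact congrArg _ (φ.2 g)

/-- **The `Δ`-action on the invariants `Maps(G ⧸ W, M)^G`** (restriction of the right translations).
[cite: SerreLocalFields1979, VII §5] -/
def coindOpenInvariantsRep :
    Representation ℤ (G ⧸ W) (ρ.coindOpen W hW).toTopRep.ρ.invariants where
  toFun c := ((ρ.coindOpenRTrans W hW c).hom.toLinearMap.restrictScalars ℤ).restrict
    fun φ hφ => ρ.coindOpenRTrans_mem_invariants W hW c ⟨φ, hφ⟩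
  map_one' := by
    ext φ
    exact congr_fun (ρ.coindOpenRTrans_one_apply W hW (φ : G ⧸ W → M)) _
  map_mul' := fun c d => by
    ext φ
    exact congr_fun (ρ.coindOpenRTrans_mul_apply W hW c d (φ : G ⧸ W → M)) _

/-- Unfolding `coindOpenInvariantsRep`. [cite: SerreLocalFields1979, VII §5] -/
@[simp] theorem coindOpenInvariantsRep_apply_coe (c : G ⧸ W)
    (φ : (ρ.coindOpen W hW).toTopRep.ρ.invariants) (y : G ⧸ W) :
    ((ρ.coindOpenInvariantsRep W hW c φ : (ρ.coindOpen W hW).toTopRep.ρ.invariants) : G ⧸ W → M) y =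
      (φ : G ⧸ W → M) (y * c) := rfl

omit [IsTopologicalGroup G] [CompactSpace G] [DiscreteTopology M] [W.Normal] in
/-- A `G`-invariant function is determined by its value at the unit coset: `φ(g W) = g • φ(1)`.
[cite: NeukirchSchmidtWingberg2008, I §6 (induced modules)] -/
theorem apply_eq_of_mem_invariants {φ : G ⧸ W → M}
    (hφ : ∀ g : G, (fun y => ρ g (φ (g⁻¹ • y))) = φ) (g : G) :
    φ (g : G ⧸ W) = ρ g (φ ((1 : G) : G ⧸ W)) := by
  have h := congr_fun (hφ g) (g : G ⧸ W)
  rw [MulAction.Quotient.smul_coe, smul_eq_mul, inv_mul_cancel] at h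
  exact h.symm

/-- The value at the unit coset of a `G`-invariant function is `W`-invariant.
[cite: NeukirchSchmidtWingberg2008, I §6 (induced modules)] -/
theorem apply_one_mem_invariantsOf (φ : (ρ.coindOpen W hW).toTopRep.ρ.invariants) :
    (φ : G ⧸ W → M) ((1 : G) : G ⧸ W) ∈ ρ.invariantsOf W := fun w => by
  have h := ρ.apply_eq_of_mem_invariants W (φ := (φ : G ⧸ W → M)) (fun g => φ.2 g) (w : G)
  change ρ (w : G) ((φ : G ⧸ W → M) ((1 : G) : G ⧸ W)) = _
  rw [← h, (QuotientGroup.eq_one_iff (w : G)).2 w.2]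
  rfl

/-- **`Maps(G ⧸ W, M)^G ≃ₗ[ℤ] M^W`, `φ ↦ φ(1)`** (inverse: `m ↦ (g W ↦ g • m)`).
[cite: NeukirchSchmidtWingberg2008, I §6 (induced modules)] [cite: SerreLocalFields1979, VII §5] -/
def coindOpenInvariantsEquiv : (ρ.coindOpen W hW).toTopRep.ρ.invariants ≃ₗ[ℤ] ρ.invariantsOf W where
  toFun φ := ⟨(φ : G ⧸ W → M) ((1 : G) : G ⧸ W), ρ.apply_one_mem_invariantsOf W hW φ⟩
  map_add' _ _ := rfl
  map_smul' _ _ := rfl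
  invFun m := ⟨fun y => Quotient.liftOn' y (fun g : G => ρ g (m : M)) fun g h hgh => by
      rw [QuotientGroup.leftRel_apply] at hgh
      have h1 : h = g * (g⁻¹ * h) := by rw [mul_inv_cancel_left]
      rw [h1, map_mul, Module.End.mul_apply]
      exact congrArg (ρ g) (m.2 ⟨g⁻¹ * h, hgh⟩).symm,
    fun g => funext fun y => by
      induction y using QuotientGroup.induction_on with
      | H x =>
        change ρ g (Quotient.liftOn' (g⁻¹ • (x : G ⧸ W)) (fun g : G => ρ g (m : M)) _) = ρ x (m : M)
        rw [MulAction.Quotient.smul_coe, smul_eq_mul]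
        change ρ g (ρ (g⁻¹ * x) (m : M)) = ρ x (m : M)
        rw [← Module.End.mul_apply, ← map_mul, mul_inv_cancel_left]⟩
  left_inv φ := by
    apply Subtype.ext
    funext y
    induction y using QuotientGroup.induction_on with
    | H g => exact (ρ.apply_eq_of_mem_invariants W (fun g => φ.2 g) g).symm
  right_inv m := by
    apply Subtype.ext
    change ρ 1 (m : M) = m
    rw [map_one, Module.End.one_apply]

/-- Formula: `coindOpenInvariantsEquiv φ = φ(1)`. [cite: NeukirchSchmidtWingberg2008, I §6 (induced modules)] -/
@[simp] theorem coindOpenInvariantsEquiv_apply_coe (φ : (ρ.coindOpen W hW).toTopRep.ρ.invariants) :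
    ((ρ.coindOpenInvariantsEquiv W hW φ : ρ.invariantsOf W) : M) = (φ : G ⧸ W → M) ((1 : G) : G ⧸ W) :=
  rfl

/-- **`H⁰(G, Ind_W^G M) = M^W` as `Δ`-modules**: `coindOpenInvariantsEquiv` intertwines the right
translation `R_c` with the natural action of `c ∈ G ⧸ W` on `M^W` (`ContinuousRep.quotientInvariants`):
`(R_{gW} φ)(1) = φ(g W) = g • φ(1)`. [cite: SerreLocalFields1979, VII §5] -/
theorem coindOpenInvariantsEquiv_rep (c : G ⧸ W) (φ : (ρ.coindOpen W hW).toTopRep.ρ.invariants) :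
    ρ.coindOpenInvariantsEquiv W hW (ρ.coindOpenInvariantsRep W hW c φ) =
      ρ.quotientInvariants W c (ρ.coindOpenInvariantsEquiv W hW φ) := by
  induction c using QuotientGroup.induction_on with
  | H g =>
    apply Subtype.ext
    change (φ : G ⧸ W → M) (((1 : G) : G ⧸ W) * (g : G ⧸ W)) =
      ρ g ((φ : G ⧸ W → M) ((1 : G) : G ⧸ W))
    rw [← QuotientGroup.mk_mul, one_mul]
    exact ρ.apply_eq_of_mem_invariants W (fun g => φ.2 g) g

end Invariants

/-! ## §4 Short exact sequences: `Maps(Δ, –)` is exact and the connecting maps are `Δ`-equivariant -/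

section SES

variable {G : Type u} [Group G] [TopologicalSpace G] [IsTopologicalGroup G] [CompactSpace G]
  [LocallyCompactSpace G]
variable {M₁ : Type u} [AddCommGroup M₁] [TopologicalSpace M₁] [DiscreteTopology M₁]
variable {M₂ : Type u} [AddCommGroup M₂] [TopologicalSpace M₂] [DiscreteTopology M₂]
variable {M₃ : Type u} [AddCommGroup M₃] [TopologicalSpace M₃] [DiscreteTopology M₃]
variable {ρ₁ : ContinuousRep G ℤ M₁} {ρ₂ : ContinuousRep G ℤ M₂} {ρ₃ : ContinuousRep G ℤ M₃}
variable {f : ρ₁.toTopRep ⟶ ρ₂.toTopRep} {g : ρ₂.toTopRep ⟶ ρ₃.toTopRep}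
variable (W : Subgroup G) [W.Normal] (hW : IsOpen (W : Set G))

omit [LocallyCompactSpace G] [W.Normal] in
/-- **`Maps(G ⧸ W, –)` preserves short exact sequences** (exactness is checked pointwise).
[cite: NeukirchSchmidtWingberg2008, I §6 (induced modules)] -/
theorem _root_.Literature.NumberTheory.GaloisRepresentations.IsSES.coindOpenMap (h : IsSES f g)
    [DiscreteTopology (G ⧸ W → M₁)] [DiscreteTopology (G ⧸ W → M₂)] [DiscreteTopology (G ⧸ W → M₃)] :
    IsSES (ρ₁.coindOpenMap ρ₂ W hW f) (ρ₂.coindOpenMap ρ₃ W hW g) where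
  comp_eq_zero := by
    ext φ y
    change g.hom (f.hom (φ y)) = 0
    exact h.g_f_apply (φ y)
  injective := fun φ ψ hφψ => funext fun y => h.injective (congr_fun hφψ y)
  exact_mid := fun φ hφ => by
    choose s hs using fun y => h.exact_mid (φ y) (congr_fun hφ y)
    exact ⟨s, funext hs⟩
  surjective := fun φ => by
    choose s hs using fun y => h.surjective (φ y)
    exact ⟨s, funext hs⟩

omit [LocallyCompactSpace G] in
/-- **`δ₀` is `Δ`-equivariant**: `δ₀ (R_c v) = H¹(R_c) (δ₀ v)` for the short exact sequence of
coinduced modules. [cite: NeukirchSchmidtWingberg2008, (1.3.3)] [cite: SerreLocalFields1979, VII §5] -/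
theorem _root_.Literature.NumberTheory.GaloisRepresentations.IsSES.δ₀_coindOpenInvariantsRep
    (h : IsSES f g) [DiscreteTopology (G ⧸ W → M₁)] [DiscreteTopology (G ⧸ W → M₂)]
    [DiscreteTopology (G ⧸ W → M₃)] (c : G ⧸ W) (v : (ρ₃.coindOpen W hW).toTopRep.ρ.invariants) :
    (h.coindOpenMap W hW).δ₀ (ρ₃.coindOpenInvariantsRep W hW c v) =
      ρ₁.coindOpenHRep W hW 1 c ((h.coindOpenMap W hW).δ₀ v) := by
  rw [coindOpenHRep_apply]
  exact (IsSES.cohomologyMap_δ₀ (h.coindOpenMap W hW) (h.coindOpenMap W hW)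
    (φ₁ := ρ₁.coindOpenRTrans W hW c) (φ₂ := ρ₂.coindOpenRTrans W hW c)
    (φ₃ := ρ₃.coindOpenRTrans W hW c) (fun _ => rfl) (fun _ => rfl) v).symm

/-- **`δ₁` is `Δ`-equivariant**: `δ₁ (H¹(R_c) x) = H²(R_c) (δ₁ x)`.
[cite: NeukirchSchmidtWingberg2008, (1.3.3)] [cite: SerreLocalFields1979, VII §5] -/
theorem _root_.Literature.NumberTheory.GaloisRepresentations.IsSES.δ₁_coindOpenHRep
    (h : IsSES f g) [DiscreteTopology (G ⧸ W → M₁)] [DiscreteTopology (G ⧸ W → M₂)]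
    [DiscreteTopology (G ⧸ W → M₃)] (c : G ⧸ W) (x : continuousCohomology 1 (ρ₃.coindOpen W hW).toTopRep) :
    (h.coindOpenMap W hW).δ₁ (ρ₃.coindOpenHRep W hW 1 c x) =
      ρ₁.coindOpenHRep W hW 2 c ((h.coindOpenMap W hW).δ₁ x) := by
  rw [coindOpenHRep_apply, coindOpenHRep_apply]
  exact (IsSES.cohomologyMap_δ₁ (h.coindOpenMap W hW) (h.coindOpenMap W hW)
    (φ₁ := ρ₁.coindOpenRTrans W hW c) (φ₂ := ρ₂.coindOpenRTrans W hW c)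
    (φ₃ := ρ₃.coindOpenRTrans W hW c) (fun _ => rfl) (fun _ => rfl) x).symm

omit [LocallyCompactSpace G] in
/-- The maps `Hⁿ(coindOpenMap f)`, `Hⁿ(coindOpenMap g)` of the long exact sequence are
`Δ`-equivariant (restated from `coindOpenHRep_cohomologyMap` for the two arrows of the sequence).
[cite: NeukirchSchmidtWingberg2008, (1.3.2)] -/
theorem _root_.Literature.NumberTheory.GaloisRepresentations.IsSES.coindOpenHRep_maps (n : ℕ) (c : G ⧸ W)
    (x : continuousCohomology n (ρ₁.coindOpen W hW).toTopRep)
    (y : continuousCohomology n (ρ₂.coindOpen W hW).toTopRep) :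
    ρ₂.coindOpenHRep W hW n c ((cohomologyMap (ρ₁.coindOpenMap ρ₂ W hW f) n).hom x) =
        (cohomologyMap (ρ₁.coindOpenMap ρ₂ W hW f) n).hom (ρ₁.coindOpenHRep W hW n c x) ∧
      ρ₃.coindOpenHRep W hW n c ((cohomologyMap (ρ₂.coindOpenMap ρ₃ W hW g) n).hom y) =
        (cohomologyMap (ρ₂.coindOpenMap ρ₃ W hW g) n).hom (ρ₂.coindOpenHRep W hW n c y) :=
  ⟨ρ₁.coindOpenHRep_cohomologyMap ρ₂ W hW f n c x, ρ₂.coindOpenHRep_cohomologyMap ρ₃ W hW g n c y⟩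

end SES

end ContinuousRep

end Literature.NumberTheory.GaloisRepresentations

end
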